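import Summits.KontsevichZagierPeriods.KontsevichZagierPeriods.Theorems.SoloBlindTriplThird
import HarnessLib

/-!
# Solo/blind — Triplication V: the orbit merges, for every rational `a`

Combining the four triplication shadows (`SoloBlindTriplication`: `3a+b=1`, `3a+b=2` with
`a > 1/2`; `SoloBlindTriplSecond`: `3a+b=2`, `a < 1/2`; `SoloBlindTriplThird`: `3a+b=3`) with the
cyclic relations of the two kinds, the `S₃`-orbit of `{a, ·, ·}` attached to `β(a, k-3a)` merges
IN `Q` with a level-`3a` orbit for every rational `a ∈ (0,1) ∖ {1/3, 1/2, 2/3}`: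

* `0 < a < 1/3`:   `β(a, 1-3a) ≐ β(2a, 1/3-a)`      (`betaQ_propTo_tripl0`);
* `1/3 < a < 1/2`: `β(a, 2-3a) ≐ β(2a, 2/3-a)`      (`betaQ_propTo_tripl1_second`, here);
* `1/2 < a < 2/3`: `β(a, 2-3a) ≐ β(2a-1, 2/3-a)`    (`betaQ_propTo_tripl1`);
* `2/3 < a < 1`:   `β(a, 3-3a) ≐ β(2a-1, 4/3-a)`    (`betaQ_propTo_tripl2_second`, here),

`x ≐ y` meaning `x = c • y`, `c ∈ K₀^×`.  The second-kind cases need the weighted orbit relation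
`orbit_pair2` (from `betaQ_second_rat`) and are closed by `linear_combination` in the module `Q`.
-/

namespace Summit.KontsevichZagierPeriods.KontsevichZagierPeriods.Theorems

open Literature.NumberTheory.Transcendental Literature.NumberTheory.Transcendental.KZ
open Set

noncomputable section

namespace SoloBlind

/-- `sin(πp) - sin(πq) ≠ 0` for `q < 1`, `1 - q < p ≤ 1/2` (then `sin(πq) = sin(π(1-q)) < sin(πp)`). -/
theorem sinQ_sub_sinQ_ne_zero' {p q : ℚ} (hq1 : q < 1) (hqp : 1 - q < p) (hp : p ≤ 1 / 2) :
    sinQ p - sinQ q ≠ 0 := by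
  intro h
  have h' := congrArg (fun z : K₀ => (z : ℝ)) h
  simp only [AddSubgroupClass.coe_sub, sinQ_val, ZeroMemClass.coe_zero] at h'
  have hq : (q:ℝ) < 1 := by exact_mod_cast hq1
  have hqp' : 1 - (q:ℝ) < p := by exact_mod_cast hqp
  have hp' : (p:ℝ) ≤ 1 / 2 := by
    rw [show (1:ℝ) / 2 = ((1 / 2 : ℚ) : ℝ) by norm_num]; exact_mod_cast hp
  have hπ := Real.pi_pos
  have h1q : (0:ℝ) < 1 - q := by linarith
  have hp0 : (0:ℝ) < p := by linarith
  have hlt : Real.sin (Real.pi * q) < Real.sin (Real.pi * p) := by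
    rw [← Real.sin_pi_sub (Real.pi * q), show Real.pi - Real.pi * q = Real.pi * (1 - q) by ring]
    exact Real.strictMonoOn_sin ⟨by nlinarith, by nlinarith⟩ ⟨by nlinarith, by nlinarith⟩
      (by nlinarith)
  linarith

/-- **Weighted orbit relation, second kind**: for rational `A, B, C ∈ (0,1)` with `A+B+C = 2`,
`(1-B) sin(πC) • β(A,C) = (1-C) sin(πB) • β(A,B)` in `Q`. -/
theorem orbit_pair2 (A B C : ℚ) (hA0 : 0 < A) (hB0 : 0 < B) (hC0 : 0 < C) (hA1 : A < 1)
    (hB1 : B < 1) (hC1 : C < 1) (h : A + B + C = 2) :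
    ((1 - B : ℚ) : K₀) • sinQ C • betaQ A C = ((1 - C : ℚ) : K₀) • sinQ B • betaQ A B := by
  have h1 := betaQ_second_rat C B hC1 hB1 (by linarith)
  rw [show 2 - C - B = A by linarith, betaQ_symm hC0 hA0, betaQ_symm hB0 hA0] at h1
  exact h1

/-- **Triplication merge (`3a+b=2`, `1/3 < a < 1/2`): `β(a, 2-3a) ≐ β(2a, 2/3-a)`** — the
second-kind orbit of `{a, 2a, 2-3a}` merges with the second-kind orbit of `{2a, 2/3-a, 4/3-a}`. -/
theorem betaQ_propTo_tripl1_second (a : ℚ) (ha3 : 1 / 3 < a) (ha2 : a < 1 / 2) :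
    PropTo (betaQ a (2 - 3 * a)) (betaQ (2 * a) (2 / 3 - a)) := by
  have key := betaQ_tripl1_second a (2 - 3 * a) (by linarith) (by linarith) (by ring)
  rw [show (2 - 3 * a) / 3 = 2 / 3 - a by ring, show (2 - 3 * a + 2) / 3 = 4 / 3 - a by ring]
    at key
  have hp := orbit_pair2 (2 * a) (2 / 3 - a) (4 / 3 - a) (by linarith) (by linarith)
    (by linarith) (by linarith) (by linarith) (by linarith) (by ring)
  refine PropTo.of_smul_eq_smul
    (c := ((1 - 2 * a : ℚ) : K₀) * ((((1 - (2 / 3 - a)) : ℚ) : K₀) * sinQ (4 / 3 - a)))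
    (c' := triCoeff (2 - 3 * a) * ((((1 + 3 * a) * (3 * a - 1) / 9 : ℚ)) : K₀) *
      (sinQ (2 / 3 - a) - sinQ (4 / 3 - a)))
    (mul_ne_zero (Rat.cast_ne_zero.mpr (by linarith : (0:ℚ) < 1 - 2 * a).ne')
      (mul_ne_zero (Rat.cast_ne_zero.mpr (by linarith : (0:ℚ) < 1 - (2 / 3 - a)).ne')
        (sinQ_ne_zero (by linarith) (by linarith))))
    (mul_ne_zero (mul_ne_zero (triCoeff_ne_zero _) (Rat.cast_ne_zero.mpr
      (div_pos (mul_pos (by linarith) (by linarith)) (by norm_num) :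
        (0:ℚ) < (1 + 3 * a) * (3 * a - 1) / 9).ne'))
      (sinQ_sub_sinQ_ne_zero' (by linarith) (by linarith) (by linarith))) ?_
  push_cast at key hp ⊢
  linear_combination (norm := module) (((1 - (2 / 3 - (a : K₀)))) * sinQ (4 / 3 - a)) • key +
    (triCoeff (2 - 3 * a) * ((1 + 3 * (a : K₀)) / 3)) • hp

/-- **Triplication merge (`3a+b=3`, `2/3 < a < 1`): `β(a, 3-3a) ≐ β(2a-1, 4/3-a)`** — the
second-kind orbit of `{a, 2a-1, 3-3a}` merges with the second-kind orbit of
`{2a-1, 4/3-a, 5/3-a}`. -/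
theorem betaQ_propTo_tripl2_second (a : ℚ) (ha : 2 / 3 < a) (ha1 : a < 1) :
    PropTo (betaQ a (3 - 3 * a)) (betaQ (2 * a - 1) (4 / 3 - a)) := by
  have key := betaQ_tripl2_second a (3 - 3 * a) (by linarith) (by linarith) (by ring)
  rw [show (3 - 3 * a + 1) / 3 = 4 / 3 - a by ring, show (3 - 3 * a + 2) / 3 = 5 / 3 - a by ring]
    at key
  have hp := orbit_pair2 (2 * a - 1) (4 / 3 - a) (5 / 3 - a) (by linarith) (by linarith)
    (by linarith) (by linarith) (by linarith) (by linarith) (by ring)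
  refine PropTo.of_smul_eq_smul
    (c := ((2 - 2 * a : ℚ) : K₀) * ((((1 - (4 / 3 - a)) : ℚ) : K₀) * sinQ (5 / 3 - a)))
    (c' := triCoeff (3 - 3 * a) * ((((3 * a - 1) * (3 * a - 2) / 9 : ℚ)) : K₀) *
      (sinQ (4 / 3 - a) + sinQ (5 / 3 - a)))
    (mul_ne_zero (Rat.cast_ne_zero.mpr (by linarith : (0:ℚ) < 2 - 2 * a).ne')
      (mul_ne_zero (Rat.cast_ne_zero.mpr (by linarith : (0:ℚ) < 1 - (4 / 3 - a)).ne')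
        (sinQ_ne_zero (by linarith) (by linarith))))
    (mul_ne_zero (mul_ne_zero (triCoeff_ne_zero _) (Rat.cast_ne_zero.mpr
      (div_pos (mul_pos (by linarith) (by linarith)) (by norm_num) :
        (0:ℚ) < (3 * a - 1) * (3 * a - 2) / 9).ne'))
      (sinQ_add_sinQ_ne_zero (by linarith) (by linarith) (by linarith) (by linarith))) ?_
  push_cast at key hp ⊢
  linear_combination (norm := module) (((1 - (4 / 3 - (a : K₀)))) * sinQ (5 / 3 - a)) • key +
    (triCoeff (3 - 3 * a) * ((3 * (a : K₀) - 1) / 3)) • hp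

/-! ## Level `9`: the three second-kind Deligne–Koblitz–Ogus coincidences as `≐` -/

/-- `β(4/9, 2/3) ≐ β(8/9, 2/9)` — `{4,6,8}` meets `{2,8,8}`. -/
theorem betaQ_propTo_nine_468 : PropTo (betaQ (4 / 9) (2 / 3)) (betaQ (8 / 9) (2 / 9)) := by
  have h := betaQ_propTo_tripl1_second (4 / 9) (by norm_num) (by norm_num)
  norm_num at h
  exact h

/-- `β(7/9, 2/3) ≐ β(5/9, 5/9)` — `{5,6,7}` meets `{5,5,8}`. -/
theorem betaQ_propTo_nine_567 : PropTo (betaQ (7 / 9) (2 / 3)) (betaQ (5 / 9) (5 / 9)) := by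
  have h := betaQ_propTo_tripl2_second (7 / 9) (by norm_num) (by norm_num)
  norm_num at h
  exact h

/-- `β(8/9, 1/3) ≐ β(7/9, 4/9)` — `{3,7,8}` meets `{4,7,7}`. -/
theorem betaQ_propTo_nine_378 : PropTo (betaQ (8 / 9) (1 / 3)) (betaQ (7 / 9) (4 / 9)) := by
  have h := betaQ_propTo_tripl2_second (8 / 9) (by norm_num) (by norm_num)
  norm_num at h
  exact h

end SoloBlind

end

end Summit.KontsevichZagierPeriods.KontsevichZagierPeriods.Theorems
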